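import Summits.ValiantsHypothesis.ValiantsHypothesis.Theorems.SymPencilEquivariantSdcNotQPSpinDichotomySymmetric
import HarnessLib

/-!
# ValiantsHypothesis / SymPencil — crux `SymmetrizePermPairs` (stmt-ValiantsHypothesis-17793), line
# `birth_SymmetrizePermPairs`, stub `stub_induce`, small-index regime, piece (K3): the spin
# dichotomy for `𝔖_a × 𝔖_b` (two degrees)

Helper of the item (`--supports stmt-ValiantsHypothesis-17793 --as helper`; 0 definitions, 0 named
facts).  The cut of record for the small-index regime of `stub_induce` (merged desk RULING #167,
HOME/lmr/NOTE-p7g11-17793-stub_induce-sizing.md §CUT) restricts the lift group to the preimage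
`E` of `Alt(Ω∖X₁) × Alt(Ω∖X₂) ≅ 𝔄_{n₁} × 𝔄_{n₂}` with `n₁ ≠ n₂` in general, so the spin dichotomy of
the sibling crux 17792 (`SpinDichotomy.spinDichotomy_symmetric`, stated for `𝔖_n × 𝔖_n`) is needed
for TWO DEGREES.  This file proves it:

* `factor_dichotomy'` — `factor_dichotomy` with the ambient product replaced by any group `Q`
  with a projection `π : Q →* 𝔖_n`, a complementary projection `π'` and a section `ι`;
* **`spinDichotomy_two_degree`** — for `φ : G ↠ 𝔖_a × 𝔖_b` and `ρ : G →* GL_k(ℂ)` scalar on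
  `ker φ`: either `min a b ≤ 4 (log₂ k + 1)`, or the central character of `ρ` on `ker φ` extends
  to a linear character `θ` of `φ⁻¹(𝔄_a × 𝔄_b)`.  The proof is that of `spinDichotomy_symmetric`
  verbatim (it never used `a = b`): both factors via `projective_perm_dichotomy`; the commutator
  `[ρ₁ x, ρ₂ y]` is a scalar character of `𝔖_a` in `x`, trivial on `𝔄_a` by perfectness
  (`commutator_alternatingGroup_eq_self`, `a ≥ 5`); `θ(g)` = the scalar of `ρ(g)(ρ₁(x)ρ₂(y))⁻¹`.

Honest framing: a classical theorem (Schur 1911) in helper form; `stub_induce`, the crux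
`SymPencil.SymmetrizePermPairs` and `VP ≠ VNP` remain OPEN and nothing here is progress on them.
-/

noncomputable section

set_option linter.dupNamespace false

namespace Summit.ValiantsHypothesis.ValiantsHypothesis.Theorems.SymPencilEquivariantSdcNotQP.SpinDichotomy

open Matrix Equiv

variable {k : ℕ}

/-- One `𝔖_n`-factor of a projective representation of a group `Q` with a projection
`π : Q →* 𝔖_n`, a complementary projection `π'` (`π p = 1 ∧ π' p = 1 ⇒ p = 1`) and a section `ι`
of `π` killed by `π'`: the restriction to `φ⁻¹(ker π')` is projectively linear unless
`n ≤ 4 (log₂ k + 1)` (`factor_dichotomy` of `…SpinDichotomySymmetric.lean` with `𝔖_n × 𝔖_n`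
replaced by `Q`). [folklore] -/
theorem factor_dichotomy' (hk : 1 ≤ k) {G Q Q' : Type*} [Group G] [Group Q] [Group Q'] {n : ℕ}
    (φ : G →* Q) (ρ : G →* GL (Fin k) ℂ)
    (hφ : Function.Surjective φ)
    (hker : ∀ g : G, φ g = 1 → ∃ c : ℂ,
      (ρ g : Matrix (Fin k) (Fin k) ℂ) = c • (1 : Matrix (Fin k) (Fin k) ℂ))
    (π : Q →* Perm (Fin n)) (π' : Q →* Q') (ι : Perm (Fin n) →* Q)
    (hπι : ∀ x, π (ι x) = x) (hπ'ι : ∀ x, π' (ι x) = 1)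
    (hext : ∀ p : Q, π p = 1 → π' p = 1 → p = 1) :
    n ≤ 4 * (Nat.log 2 k + 1) ∨
      ∃ ρ₁ : Perm (Fin n) →* GL (Fin k) ℂ, ∀ g : G, π' (φ g) = 1 → ∃ c : ℂ,
        c ≠ 0 ∧ (ρ g : Matrix (Fin k) (Fin k) ℂ) =
          c • (ρ₁ (π (φ g)) : Matrix (Fin k) (Fin k) ℂ) := by
  set G₁ : Subgroup G := (π'.comp φ).ker with hG₁
  set φ₁ : G₁ →* Perm (Fin n) := π.comp (φ.comp G₁.subtype) with hφ₁
  have hφ₁_surj : Function.Surjective φ₁ := by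
    intro x
    obtain ⟨g, hg⟩ := hφ (ι x)
    have hg₁ : g ∈ G₁ := by rw [hG₁, MonoidHom.mem_ker, MonoidHom.comp_apply, hg, hπ'ι]
    exact ⟨⟨g, hg₁⟩, by
      simp only [hφ₁, MonoidHom.comp_apply, Subgroup.coe_subtype, hg, hπι]⟩
  have hker₁ : ∀ g : G₁, φ₁ g = 1 → ∃ c : ℂ,
      ((ρ.comp G₁.subtype) g : Matrix (Fin k) (Fin k) ℂ) =
        c • (1 : Matrix (Fin k) (Fin k) ℂ) := by
    intro g hg
    apply hker
    have h2 : π' (φ g) = 1 := MonoidHom.mem_ker.mp g.2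
    exact hext _ hg h2
  rcases projective_perm_dichotomy hk φ₁ (ρ.comp G₁.subtype) hφ₁_surj hker₁ with
    h | ⟨ρ₁, hρ₁⟩
  · exact Or.inl h
  · refine Or.inr ⟨ρ₁, fun g hg => ?_⟩
    have hg₁ : g ∈ G₁ := by rw [hG₁, MonoidHom.mem_ker, MonoidHom.comp_apply, hg]
    obtain ⟨c, hc0, hc⟩ := hρ₁ ⟨g, hg₁⟩
    exact ⟨c, hc0, hc⟩

/-- **The spin dichotomy for `𝔖_a × 𝔖_b` (two degrees).**  For a surjection `φ : G ↠ 𝔖_a × 𝔖_b`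
and a representation `ρ : G →* GL_k(ℂ)` that is scalar on `ker φ`: either
`min a b ≤ 4 (log₂ k + 1)`, or there is a linear character `θ` of `φ⁻¹(𝔄_a × 𝔄_b)` with
`ρ(g) = θ(g) · 1` for `g ∈ ker φ` (Schur 1911; the proof of `spinDichotomy_symmetric` with two
degrees — the mixed class dies on `𝔄_a × 𝔄_b` by perfectness of `𝔄_a`, `a ≥ 5`). [folklore] -/
theorem spinDichotomy_two_degree {G : Type*} [Group G] {a b k : ℕ}
    (φ : G →* Perm (Fin a) × Perm (Fin b)) (ρ : G →* GL (Fin k) ℂ)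
    (hφ : Function.Surjective φ)
    (hker : ∀ g : G, φ g = 1 → ∃ c : ℂ,
      (ρ g : Matrix (Fin k) (Fin k) ℂ) = c • (1 : Matrix (Fin k) (Fin k) ℂ)) :
    min a b ≤ 4 * (Nat.log 2 k + 1) ∨
      ∃ θ : ↥(((alternatingGroup (Fin a)).prod (alternatingGroup (Fin b))).comap φ) →* ℂˣ,
        ∀ g : ↥(((alternatingGroup (Fin a)).prod (alternatingGroup (Fin b))).comap φ),
          φ g = 1 → ((ρ g : GL (Fin k) ℂ) : Matrix (Fin k) (Fin k) ℂ) =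
            ((θ g : ℂˣ) : ℂ) • (1 : Matrix (Fin k) (Fin k) ℂ) := by
  classical
  set AA : Subgroup (Perm (Fin a) × Perm (Fin b)) :=
    (alternatingGroup (Fin a)).prod (alternatingGroup (Fin b)) with hAA
  set G₀ : Subgroup G := AA.comap φ with hG₀
  -- `k = 0`: all `0 × 0` matrices coincide
  rcases Nat.eq_zero_or_pos k with hk0 | hk
  · subst hk0
    refine Or.inr ⟨1, fun g _ => ?_⟩
    ext i j; exact Fin.elim0 i
  -- small `a` or `b`
  have h4le : 4 ≤ 4 * (Nat.log 2 k + 1) := Nat.le_mul_of_pos_right _ (Nat.succ_pos _)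
  by_cases ha4 : a ≤ 4
  · exact Or.inl ((min_le_left a b).trans (ha4.trans h4le))
  by_cases hb4 : b ≤ 4
  · exact Or.inl ((min_le_right a b).trans (hb4.trans h4le))
  have ha5 : 5 ≤ a := by omega
  -- the two factors
  have hext1 : ∀ p : Perm (Fin a) × Perm (Fin b), MonoidHom.fst _ _ p = 1 →
      MonoidHom.snd _ _ p = 1 → p = 1 := fun p h1 h2 => Prod.ext h1 h2
  have hext2 : ∀ p : Perm (Fin a) × Perm (Fin b), MonoidHom.snd _ _ p = 1 →
      MonoidHom.fst _ _ p = 1 → p = 1 := fun p h1 h2 => Prod.ext h2 h1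
  rcases factor_dichotomy' hk φ ρ hφ hker (MonoidHom.fst _ _) (MonoidHom.snd _ _)
    (MonoidHom.inl _ _)
    (fun x => rfl) (fun x => rfl) hext1 with h | ⟨ρ₁, hρ₁⟩
  · exact Or.inl ((min_le_left a b).trans h)
  rcases factor_dichotomy' hk φ ρ hφ hker (MonoidHom.snd _ _) (MonoidHom.fst _ _)
    (MonoidHom.inr _ _)
    (fun x => rfl) (fun x => rfl) hext2 with h | ⟨ρ₂, hρ₂⟩
  · exact Or.inl ((min_le_right a b).trans h)
  right
  simp only [MonoidHom.coe_fst, MonoidHom.coe_snd] at hρ₁ hρ₂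
  -- `ρ g = c_g • ρ₁ x ρ₂ y`
  have hρ : ∀ g : G, ∃ c : ℂ, c ≠ 0 ∧ (ρ g : Matrix (Fin k) (Fin k) ℂ) =
      c • ((ρ₁ (φ g).1 : Matrix (Fin k) (Fin k) ℂ) *
        (ρ₂ (φ g).2 : Matrix (Fin k) (Fin k) ℂ)) := by
    intro g
    obtain ⟨g₁, hg₁⟩ := hφ ((φ g).1, 1)
    have hg₂ : φ (g₁⁻¹ * g) = (1, (φ g).2) := by
      rw [map_mul, map_inv, hg₁]; ext <;> simp
    obtain ⟨c₁, hc₁0, hc₁⟩ := hρ₁ g₁ (by rw [hg₁])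
    obtain ⟨c₂, hc₂0, hc₂⟩ := hρ₂ (g₁⁻¹ * g) (by rw [hg₂])
    rw [hg₁] at hc₁
    rw [hg₂] at hc₂
    refine ⟨c₁ * c₂, mul_ne_zero hc₁0 hc₂0, ?_⟩
    have e : g = g₁ * (g₁⁻¹ * g) := by rw [mul_inv_cancel_left]
    rw [e, map_mul, Units.val_mul, hc₁, hc₂, Matrix.smul_mul, Matrix.mul_smul, smul_smul, ← e]
  -- the commutator `[ρ₁ x, ρ₂ y]` is a scalar
  have hω : ∀ (x : Perm (Fin a)) (y : Perm (Fin b)), ∃ ω : ℂ,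
      (ρ₁ x : Matrix (Fin k) (Fin k) ℂ) * ρ₂ y =
      ω • ((ρ₂ y : Matrix (Fin k) (Fin k) ℂ) * ρ₁ x) := by
    intro x y
    obtain ⟨g₁, hg₁⟩ := hφ (x, 1)
    obtain ⟨g₂, hg₂⟩ := hφ (1, y)
    obtain ⟨c₁, hc₁0, hc₁⟩ := hρ g₁
    obtain ⟨c₂, hc₂0, hc₂⟩ := hρ g₂
    rw [hg₁] at hc₁
    rw [hg₂] at hc₂
    simp only [map_one, Units.val_one, Matrix.mul_one, Matrix.one_mul] at hc₁ hc₂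
    have hw : φ (g₁ * g₂ * g₁⁻¹ * g₂⁻¹) = 1 := by
      simp only [map_mul, map_inv, hg₁, hg₂]; ext <;> simp
    obtain ⟨ω, hωw⟩ := hker _ hw
    refine ⟨ω, ?_⟩
    -- `ρ(g₁ g₂) = ω • ρ(g₂ g₁)`
    have e1 : (ρ (g₁ * g₂) : Matrix (Fin k) (Fin k) ℂ) =
        ω • (ρ (g₂ * g₁) : Matrix (Fin k) (Fin k) ℂ) := by
      have e : g₁ * g₂ = (g₁ * g₂ * g₁⁻¹ * g₂⁻¹) * (g₂ * g₁) := by group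
      rw [e, map_mul, Units.val_mul, hωw, Matrix.smul_mul, Matrix.one_mul]
    rw [map_mul, map_mul, Units.val_mul, Units.val_mul, hc₁, hc₂, Matrix.smul_mul,
      Matrix.mul_smul, Matrix.smul_mul, Matrix.mul_smul, smul_smul, smul_smul, smul_smul] at e1
    have hcc : c₁ * c₂ ≠ 0 := mul_ne_zero hc₁0 hc₂0
    have e2 : (c₁ * c₂) • ((ρ₁ x : Matrix (Fin k) (Fin k) ℂ) * ρ₂ y) =
        (c₁ * c₂) • (ω • ((ρ₂ y : Matrix (Fin k) (Fin k) ℂ) * ρ₁ x)) := by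
      rw [e1, smul_smul]; congr 1; ring
    exact smul_right_injective _ hcc e2
  -- for fixed `y`, `x ↦ ω(x, y)` is a character of `𝔖_n`, trivial on `𝔄_n`
  have hcommA : ∀ y : Perm (Fin b), ∀ x : Perm (Fin a), x ∈ alternatingGroup (Fin a) →
      (ρ₁ x : Matrix (Fin k) (Fin k) ℂ) * ρ₂ y = (ρ₂ y : Matrix (Fin k) (Fin k) ℂ) * ρ₁ x := by
    intro y
    choose f hf using fun x => hω x y
    -- uniqueness of the scalar
    have huniq : ∀ x (d : ℂ), (ρ₁ x : Matrix (Fin k) (Fin k) ℂ) * ρ₂ y =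
        d • ((ρ₂ y : Matrix (Fin k) (Fin k) ℂ) * ρ₁ x) → d = f x := by
      intro x d hd
      rw [hf x] at hd
      have hd' : f x • ((ρ₂ y * ρ₁ x : GL (Fin k) ℂ) : Matrix (Fin k) (Fin k) ℂ) =
          d • ((ρ₂ y * ρ₁ x : GL (Fin k) ℂ) : Matrix (Fin k) (Fin k) ℂ) := by
        rw [Units.val_mul]; exact hd
      exact (smul_unit_injective hk _ hd').symm
    have hf1 : f 1 = 1 := (huniq 1 1 (by rw [map_one, Units.val_one, Matrix.one_mul,
      Matrix.mul_one, one_smul])).symm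
    have hfmul : ∀ x x', f (x * x') = f x * f x' := by
      intro x x'
      symm
      apply huniq
      rw [map_mul, Units.val_mul, Matrix.mul_assoc, hf x', Matrix.mul_smul, ← Matrix.mul_assoc,
        hf x,
        Matrix.smul_mul, smul_smul, Matrix.mul_assoc, mul_comm (f x') (f x)]
    have hf0 : ∀ x, f x ≠ 0 := by
      intro x h0
      have := hfmul x x⁻¹
      rw [mul_inv_cancel, hf1, h0, zero_mul] at this
      exact one_ne_zero this
    let F : Perm (Fin a) →* ℂˣ :=
      { toFun := fun x => Units.mk0 (f x) (hf0 x)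
        map_one' := by ext; simp [hf1]
        map_mul' := fun x x' => by ext; simp [hfmul] }
    have hFker : alternatingGroup (Fin a) ≤ F.ker := by
      have h5 : 5 ≤ Nat.card (Fin a) := by
        rw [Nat.card_eq_fintype_card, Fintype.card_fin]; exact ha5
      calc alternatingGroup (Fin a) = ⁅alternatingGroup (Fin a), alternatingGroup (Fin a)⁆ :=
            (commutator_alternatingGroup_eq_self h5).symm
        _ ≤ ⁅(⊤ : Subgroup (Perm (Fin a))), ⊤⁆ := Subgroup.commutator_mono le_top le_top
        _ = commutator (Perm (Fin a)) := (commutator_def _).symm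
        _ ≤ F.ker := Abelianization.commutator_subset_ker F
    intro x hx
    have hFx : F x = 1 := hFker hx
    have hfx : f x = 1 := by
      have := congrArg (fun u : ℂˣ => (u : ℂ)) hFx
      simpa [F] using this
    rw [hf x, hfx, one_smul]
  -- `M(g) = ρ₁ x ρ₂ y` is multiplicative against `G₀` on the right
  set M : G → GL (Fin k) ℂ := fun g => ρ₁ (φ g).1 * ρ₂ (φ g).2 with hM
  have hMval : ∀ g : G, ((M g : GL (Fin k) ℂ) : Matrix (Fin k) (Fin k) ℂ) =
      (ρ₁ (φ g).1 : Matrix (Fin k) (Fin k) ℂ) * ρ₂ (φ g).2 := fun g => Units.val_mul _ _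
  have hMmul : ∀ g h : G, h ∈ G₀ → M (g * h) = M g * M h := by
    intro g h hh
    have hh' : (φ h).1 ∈ alternatingGroup (Fin a) := by
      rw [hG₀, Subgroup.mem_comap, hAA, Subgroup.mem_prod] at hh; exact hh.1
    apply Units.ext
    simp only [hM, map_mul, Prod.fst_mul, Prod.snd_mul, Units.val_mul]
    simp only [Matrix.mul_assoc]
    congr 1
    rw [← Matrix.mul_assoc, hcommA (φ g).2 (φ h).1 hh', Matrix.mul_assoc]
  have hM1 : M 1 = 1 := by
    apply Units.ext; rw [hMval, map_one, Prod.fst_one, Prod.snd_one, map_one, map_one,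
      Units.val_one, Matrix.mul_one]
  -- the scalar `c_g` with `ρ g = c_g • M g`
  set i₀ : Fin k := ⟨0, hk⟩ with hi₀
  set c : G → ℂ := fun g =>
    ((ρ g * (M g)⁻¹ : GL (Fin k) ℂ) : Matrix (Fin k) (Fin k) ℂ) i₀ i₀ with hc
  have hS : ∀ g : G, ((ρ g * (M g)⁻¹ : GL (Fin k) ℂ) : Matrix (Fin k) (Fin k) ℂ) =
      c g • (1 : Matrix (Fin k) (Fin k) ℂ) := by
    intro g
    obtain ⟨d, -, hd⟩ := hρ g
    have h1 : ((ρ g * (M g)⁻¹ : GL (Fin k) ℂ) : Matrix (Fin k) (Fin k) ℂ) =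
        d • (1 : Matrix (Fin k) (Fin k) ℂ) := by
      rw [Units.val_mul, hd, ← hMval, Matrix.smul_mul, Units.mul_inv]
    have hcd : c g = d := smul_one_apply_eq i₀ h1
    rw [hcd]; exact h1
  have hc0 : ∀ g : G, c g ≠ 0 := fun g => scalar_ne_zero_of_unit hk _ (hS g)
  have hρc : ∀ g : G, (ρ g : Matrix (Fin k) (Fin k) ℂ) =
      c g • ((M g : GL (Fin k) ℂ) : Matrix (Fin k) (Fin k) ℂ) := by
    intro g
    have e : ρ g = ρ g * (M g)⁻¹ * M g := (inv_mul_cancel_right _ _).symm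
    rw [e, Units.val_mul, hS g, Matrix.smul_mul, Matrix.one_mul]
  have hc1 : c 1 = 1 := by
    have h := hρc 1
    rw [map_one, hM1, Units.val_one] at h
    exact (smul_one_injective hk (by rw [one_smul]; exact h)).symm
  have hcmul : ∀ g h : G, h ∈ G₀ → c (g * h) = c g * c h := by
    intro g h hh
    apply smul_unit_injective hk (M (g * h))
    calc c (g * h) • ((M (g * h) : GL (Fin k) ℂ) : Matrix (Fin k) (Fin k) ℂ)
        = (ρ (g * h) : Matrix (Fin k) (Fin k) ℂ) := (hρc _).symm
      _ = (ρ g : Matrix (Fin k) (Fin k) ℂ) * ρ h := by rw [map_mul, Units.val_mul]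
      _ = (c g * c h) •
          (((M g : GL (Fin k) ℂ) : Matrix (Fin k) (Fin k) ℂ) * (M h : GL (Fin k) ℂ)) := by
          rw [hρc g, hρc h, Matrix.smul_mul, Matrix.mul_smul, smul_smul]
      _ = (c g * c h) • ((M (g * h) : GL (Fin k) ℂ) : Matrix (Fin k) (Fin k) ℂ) := by
          rw [hMmul g h hh, ← Units.val_mul]
  -- the character `θ`
  let θ : G₀ →* ℂˣ :=
    { toFun := fun g => Units.mk0 (c g) (hc0 g)
      map_one' := by ext; simp [hc1]
      map_mul' := fun g h => by ext; simp [hcmul g h h.2] }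
  refine ⟨θ, fun g hg => ?_⟩
  have hMg : M g = 1 := by
    apply Units.ext
    rw [hMval, hg, Prod.fst_one, Prod.snd_one, map_one, map_one, Units.val_one, Matrix.mul_one]
  have := hρc g
  rw [hMg, Units.val_one] at this
  exact this

end Summit.ValiantsHypothesis.ValiantsHypothesis.Theorems.SymPencilEquivariantSdcNotQP.SpinDichotomy

end
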